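import Summits.QuantumFields.YangMills.Theorems.BalabanUVNodesN15KingModelComplexLinkNeumann
import Mathlib.Analysis.Analytic.Constructions
import Mathlib.Analysis.Calculus.FDeriv.Mul
import Mathlib.Analysis.Calculus.FDeriv.Analytic
import HarnessLib
/-!
# BalabanUVNodes ∕ N15 — THE KING-MODEL RUNG (PART Ϛ-e): HOLOMORPHY IN THE LINK FIELD — `(U,V) ↦ G_{U,V} = M_{U,V}⁻¹` IS ANALYTIC wherever `M_{U,V}` is invertible, in particular on a
# neighbourhood of the closed complex window `‖U(b)‖, ‖V(b)‖ ≤ 1+ε`, `2(d+1)cε < m²` and at every unitary field; the EXACT derivative `∂G[δU,δV] = G·T_{δU,δV}·G`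
# (Track A, DAG node N15 = NE2; FAN-OUT v1.1 §N15 s3 «KING-MODEL RUNG … + what the curved case adds»; count-neutral)
HONEST FRAMING.  Count-neutral (cell `pub-ymgap`, seat `pub-ymgap-dag-n15-e` g43; `--supports stmt-QuantumFields-27247 --as helper` = K3ᴬ, KEY MAP v3).  One finite torus at fixed
spacing; King's `A = 0` model, FINE covariance layer only; nothing of Bałaban's (3.42) ∕ Thm 3.4 for `G(U)` asserted; nothing continuum ∕ ℝ⁴ ∕ OS ∕ Clay; NOT a node discharge.
THE STATEMENT DECIDED IN THE MODEL.  [Balaban1985BackgroundPropagators] §3.B p.399 l.37–40 «We would like to prove that this dependence is analytic. The simplest way to do it is to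
extend the operators to configurations with values in the complexified group Gᶜ and to prove the usual complex analyticity.»; Thm 3.4 p.400 «… extend to configurations U′U … as
analytic functions of A»; p.400 l.10–12 «In fact we prove quantitative statements which are more precise, describing these analytic extensions as small perturbations of the operators
depending on U only»; (3.53) p.400 `Δ_{U′U} = Δ_U − V₁(A)`.  For King's two-sided complexified fine operator (PART Ϛ-a `cxLapF K c m² U V`) on the normed space
`CxLinks K 𝕜 n = (bonds → Matrix n n 𝕜)²` (bondwise fibre-operator norm, sup over bonds):
* §1 defs `CxLinks`, **`cxHopCLM K 𝕜 n c`** (`(U,V) ↦ T_{U,V}` as a CONTINUOUS 𝕜-LINEAR map, Ϛ-a `cxHop_add`∕`cxHop_smul`), `cxBlkCLM`, `cxEntryCLM`; ★ `analyticAt_cxLapF` (`(U,V) ↦ M_{U,V}` is affine,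
  hence analytic everywhere), `hasFDerivAt_cxLapF` (derivative `−T_{·,·}`), `continuous_cxLapF`;
* §2 ★★★ **`analyticAt_cxLapF_inv`** — `(U,V) ↦ G_{U,V} = M_{U,V}⁻¹` IS ANALYTIC (over `𝕜`; HOLOMORPHIC for `𝕜 = ℂ`) AT EVERY PAIR WHERE `M_{U,V}` IS INVERTIBLE (Mathlib `analyticAt_inverse`
  in the complete normed algebra `Matrix (T×n) (T×n) 𝕜` with the `ℓ²`-operator norm, composed with §1; `Matrix.nonsing_inv_eq_ringInverse`); ★★ `isOpen_setOf_isUnit_cxLapF` (the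
  invertibility locus is OPEN, `Units.isOpen`), `analyticOnNhd_cxLapF_inv`; ★★★ **`analyticOnNhd_cxLapF_inv_window`** — analytic on (a neighbourhood of every point of) the CLOSED window
  `‖U(b)‖, ‖V(b)‖ ≤ 1+ε`, `2(d+1)cε < m²` (Ϛ-b `isUnit_cxLapF`); ★★ **`analyticAt_cxLapF_inv_unitary`** — analytic at `(U₀, U₀^*)` for every unitary `U₀`, where the value is PART Ͱ's
  `G_{U₀} = (−cΔ_{U₀}+m²)⁻¹` (`cxLapF_inv_at_unitary`); blocks and entries: `analyticAt_blk_cxLapF_inv`, `analyticAt_cxLapF_inv_entry`; `differentiableAt_cxLapF_inv`, `contDiffAt_cxLapF_inv`;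
* §3 ★★★ **`hasFDerivAt_cxLapF_inv`** — THE EXACT DERIVATIVE: `D(G)(U,V)[δU,δV] = G_{U,V}·T_{δU,δV}·G_{U,V}` (Mathlib `hasFDerivAt_ringInverse` `t ↦ −x⁻¹tx⁻¹` ∘ the affine map;
  print's first-order term of (3.53)∕(3.57) in the model), ★★ `fderiv_cxLapF_inv_apply`.
The Cauchy-free first-order BOUNDS on the window (`‖(G·T_δ·G)_{xy}‖` against King's shifted kernels) are PART Ϛ-f.
PRIOR TREE ART (by name): Ϛ-a (`cxHop`, `cxLapF`, `cxHop_add`, `cxHop_smul`, `cxLapF_adjoint`, `blk_add'`, `blk_smul'`), Ϛ-b (`isUnit_cxLapF`, `unitary_mem_window`), Ͱ-a (`covLapF`),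
`LatticeDiamagneticInequality` (`blk`), Mathlib (`analyticAt_inverse`, `hasFDerivAt_ringInverse`, `Units.isOpen`, `Matrix.nonsing_inv_eq_ringInverse`, `Matrix.coe_units_inv`,
`LinearMap.toContinuousLinearMap`, `ContinuousLinearMap.analyticAt`, `ContinuousLinearMap.mulLeftRight`, `FiniteDimensional.complete`, `Matrix.Norms.L2Operator`).  Dedup (rg at
filing): basename 0 files; needles `CxLinks|cxHopCLM|cxBlkCLM|cxEntryCLM|analyticAt_cxLapF|hasFDerivAt_cxLapF_inv` 0 tree files (sibling n15-d's `…PotentialComplex*` = analyticity in a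
scalar φ²-source coupling at `U = 1`, a different variable — not restated).  Locators: [Balaban1985BackgroundPropagators] §3.B p.399 l.37–40, Thm 3.4 p.400, p.400 l.10–12, (3.53)
p.400, (3.57) p.401; [King1986] (4.4) p.670.  0 `sorry`.
-/

noncomputable section
open scoped BigOperators ComplexConjugate ComplexOrder Topology Matrix.Norms.L2Operator
open Finset Matrix Filter

namespace Summit.QuantumFields.YangMills.BalabanUVNodes.N15KingModelRung.Covariant

open Literature.MathematicalPhysics.QuantumFieldTheory.LatticeDiamagneticInequality (Hopping blk)
open Literature.MathematicalPhysics.QuantumFieldTheory.Balaban1983to89.B5Prop11Plancherel (Tor unitVec)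
open Literature.MathematicalPhysics.QuantumFieldTheory.King1986.Torus (lapF)

variable {d : ℕ} (K : Fin (d + 1) → ℕ) [hK : ∀ μ, NeZero (K μ)]
variable {𝕜 : Type*} [RCLike 𝕜] {n : Type*} [Fintype n] [DecidableEq n]

/-! ## §1 The space of two-sided link fields; `T` and `M` as (affine-)linear maps -/

variable (𝕜 n) in
/-- THE SPACE OF TWO-SIDED COMPLEX LINK FIELDS `(U, V)`: pairs of bond functions with values in `n × n` matrices, normed bondwise by the fibre operator norm (sup over bonds).
[cite: Balaban1985BackgroundPropagators, §3.B p.399 l.37–40, (3.37) p.396] -/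
abbrev CxLinks : Type _ := (Tor K × Fin (d + 1) → Matrix n n 𝕜) × (Tor K × Fin (d + 1) → Matrix n n 𝕜)

/-- `(U,V) ↦ T_{U,V}` as a 𝕜-linear map (Ϛ-a `cxHop_add`, `cxHop_smul`). [cite: Balaban1985BackgroundPropagators, (3.50)–(3.53) p.400] -/
def cxHopLin (c : ℝ) : CxLinks K 𝕜 n →ₗ[𝕜] Matrix (Tor K × n) (Tor K × n) 𝕜 where
  toFun UV := cxHop K c UV.1 UV.2
  map_add' UV UV' := cxHop_add K c UV.1 UV'.1 UV.2 UV'.2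
  map_smul' a UV := by
    rw [RingHom.id_apply]
    exact cxHop_smul K c a UV.1 UV.2

variable (𝕜 n) in
/-- **`(U,V) ↦ T_{U,V}` AS A CONTINUOUS 𝕜-LINEAR MAP** (finite dimension). [cite: Balaban1985BackgroundPropagators, (3.50)–(3.53) p.400] -/
def cxHopCLM (c : ℝ) : CxLinks K 𝕜 n →L[𝕜] Matrix (Tor K × n) (Tor K × n) 𝕜 :=
  LinearMap.toContinuousLinearMap (cxHopLin K c)

omit [DecidableEq n] in
/-- `cxHopCLM K 𝕜 n c (U,V) = T_{U,V}`. [folklore] -/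
@[simp] theorem cxHopCLM_apply (c : ℝ) (UV : CxLinks K 𝕜 n) : cxHopCLM K 𝕜 n c UV = cxHop K c UV.1 UV.2 := rfl

variable (𝕜 n) in
/-- The block read-out `A ↦ A_{xy}` as a continuous 𝕜-linear map. [folklore] -/
def cxBlkCLM (x y : Tor K) : Matrix (Tor K × n) (Tor K × n) 𝕜 →L[𝕜] Matrix n n 𝕜 :=
  LinearMap.toContinuousLinearMap
    { toFun := fun A => blk A x y
      map_add' := fun A B => blk_add' K A B x y
      map_smul' := fun a A => by rw [RingHom.id_apply]; exact blk_smul' K a A x y }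

omit [DecidableEq n] in
/-- `cxBlkCLM K 𝕜 n x y A = A_{xy}`. [folklore] -/
@[simp] theorem cxBlkCLM_apply (x y : Tor K) (A : Matrix (Tor K × n) (Tor K × n) 𝕜) : cxBlkCLM K 𝕜 n x y A = blk A x y := rfl

variable (𝕜) in
/-- The entry read-out `A ↦ A(p,q)` as a continuous 𝕜-linear map. [folklore] -/
def cxEntryCLM (p q : Tor K × n) : Matrix (Tor K × n) (Tor K × n) 𝕜 →L[𝕜] 𝕜 :=
  LinearMap.toContinuousLinearMap
    { toFun := fun A => A p q
      map_add' := fun _ _ => rfl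
      map_smul' := fun _ _ => rfl }

omit [DecidableEq n] in
/-- `cxEntryCLM K 𝕜 p q A = A(p,q)`. [folklore] -/
@[simp] theorem cxEntryCLM_apply (p q : Tor K × n) (A : Matrix (Tor K × n) (Tor K × n) 𝕜) : cxEntryCLM K 𝕜 p q A = A p q := rfl

/-- `(U,V) ↦ M_{U,V} = D₀·1 − T_{U,V}` is the constant `D₀·1` minus the continuous linear map `cxHopCLM`. [cite: Balaban1985BackgroundPropagators, (3.53) p.400] -/
theorem cxLapF_eq_const_sub (c m2 : ℝ) :
    (fun UV : CxLinks K 𝕜 n => cxLapF K c m2 UV.1 UV.2)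
      = fun UV => diagonal (fun _ : Tor K × n => ((m2 + 2 * ((d : ℝ) + 1) * c : ℝ) : 𝕜)) - cxHopCLM K 𝕜 n c UV := rfl

/-- ★ **`(U,V) ↦ M_{U,V}` IS ANALYTIC EVERYWHERE** (affine). [cite: Balaban1985BackgroundPropagators, §3.B p.399 l.37–40] -/
theorem analyticAt_cxLapF (c m2 : ℝ) (UV₀ : CxLinks K 𝕜 n) : AnalyticAt 𝕜 (fun UV : CxLinks K 𝕜 n => cxLapF K c m2 UV.1 UV.2) UV₀ := by
  rw [cxLapF_eq_const_sub]
  exact analyticAt_const.sub ((cxHopCLM K 𝕜 n c).analyticAt UV₀)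

/-- THE DERIVATIVE OF `(U,V) ↦ M_{U,V}` is `(δU,δV) ↦ −T_{δU,δV}`. [cite: Balaban1985BackgroundPropagators, (3.53) p.400] -/
theorem hasFDerivAt_cxLapF (c m2 : ℝ) (UV₀ : CxLinks K 𝕜 n) :
    HasFDerivAt (fun UV : CxLinks K 𝕜 n => cxLapF K c m2 UV.1 UV.2) (-cxHopCLM K 𝕜 n c) UV₀ := by
  rw [cxLapF_eq_const_sub]
  exact ((cxHopCLM K 𝕜 n c).hasFDerivAt).const_sub _

/-- `(U,V) ↦ M_{U,V}` is continuous. [folklore] -/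
theorem continuous_cxLapF (c m2 : ℝ) : Continuous (fun UV : CxLinks K 𝕜 n => cxLapF K c m2 UV.1 UV.2) := by
  rw [cxLapF_eq_const_sub]
  exact continuous_const.sub (cxHopCLM K 𝕜 n c).continuous

/-! ## §2 Analyticity of `(U,V) ↦ G_{U,V}` -/

/-- `G_{U,V} = M_{U,V}⁻¹` IS `Ring.inverse` of the affine map (Mathlib's matrix inverse agrees with `Ring.inverse` on all matrices). [folklore] -/
theorem cxLapF_inv_eq_ringInverse_comp (c m2 : ℝ) :
    (fun UV : CxLinks K 𝕜 n => (cxLapF K c m2 UV.1 UV.2)⁻¹) = Ring.inverse ∘ (fun UV : CxLinks K 𝕜 n => cxLapF K c m2 UV.1 UV.2) := by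
  funext UV
  exact Matrix.nonsing_inv_eq_ringInverse _

/-- ★★★ **HOLOMORPHY IN THE LINK FIELD**: `(U,V) ↦ G_{U,V} = M_{U,V}⁻¹` is ANALYTIC (over `𝕜`; holomorphic for `𝕜 = ℂ`) at every two-sided field where `M_{U,V}` is invertible.
[cite: Balaban1985BackgroundPropagators, Thm 3.4 p.400, §3.B p.399 l.37–40] -/
theorem analyticAt_cxLapF_inv {c m2 : ℝ} {UV₀ : CxLinks K 𝕜 n} (hU : IsUnit (cxLapF K c m2 UV₀.1 UV₀.2)) :
    AnalyticAt 𝕜 (fun UV : CxLinks K 𝕜 n => (cxLapF K c m2 UV.1 UV.2)⁻¹) UV₀ := by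
  haveI : CompleteSpace (Matrix (Tor K × n) (Tor K × n) 𝕜) := FiniteDimensional.complete 𝕜 _
  rw [cxLapF_inv_eq_ringInverse_comp]
  exact (analyticAt_inverse (𝕜 := 𝕜) hU.unit).comp_of_eq (analyticAt_cxLapF K c m2 UV₀) hU.unit_spec.symm

/-- ★★ **THE INVERTIBILITY LOCUS IS OPEN** in the space of two-sided link fields. [cite: Balaban1985BackgroundPropagators, §3.B p.399 l.40 – p.400 l.3] -/
theorem isOpen_setOf_isUnit_cxLapF (c m2 : ℝ) : IsOpen {UV : CxLinks K 𝕜 n | IsUnit (cxLapF K c m2 UV.1 UV.2)} := by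
  haveI : CompleteSpace (Matrix (Tor K × n) (Tor K × n) 𝕜) := FiniteDimensional.complete 𝕜 _
  exact (Units.isOpen (R := Matrix (Tor K × n) (Tor K × n) 𝕜)).preimage (continuous_cxLapF K c m2)

/-- `G` is analytic on the (open) invertibility locus. [cite: Balaban1985BackgroundPropagators, Thm 3.4 p.400] -/
theorem analyticOnNhd_cxLapF_inv (c m2 : ℝ) :
    AnalyticOnNhd 𝕜 (fun UV : CxLinks K 𝕜 n => (cxLapF K c m2 UV.1 UV.2)⁻¹) {UV | IsUnit (cxLapF K c m2 UV.1 UV.2)} :=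
  fun _ hUV => analyticAt_cxLapF_inv K hUV

/-- THE CLOSED WINDOW LIES IN THE INVERTIBILITY LOCUS (Ϛ-b `isUnit_cxLapF`). [cite: Balaban1985BackgroundPropagators, Thm 3.4 p.400] -/
theorem window_subset_setOf_isUnit {c m2 ε : ℝ} (hc : 0 ≤ c) (hm : 0 < m2) (hε : 0 ≤ ε) (hwin : 2 * ((d : ℝ) + 1) * c * ε < m2) :
    {UV : CxLinks K 𝕜 n | (∀ b, ‖UV.1 b‖ ≤ 1 + ε) ∧ (∀ b, ‖UV.2 b‖ ≤ 1 + ε)} ⊆ {UV | IsUnit (cxLapF K c m2 UV.1 UV.2)} :=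
  fun _ h => isUnit_cxLapF K hc hm hε hwin h.1 h.2

/-- ★★★ **ANALYTIC ON THE WHOLE CLOSED COMPLEX WINDOW** `‖U(b)‖, ‖V(b)‖ ≤ 1+ε`, `2(d+1)cε < m²` (at every point of it, on a neighbourhood): the model form of «extend … as analytic
functions» of [B9] Thm 3.4, with the window of PART Ϛ-d. [cite: Balaban1985BackgroundPropagators, Thm 3.4 p.400] -/
theorem analyticOnNhd_cxLapF_inv_window {c m2 ε : ℝ} (hc : 0 ≤ c) (hm : 0 < m2) (hε : 0 ≤ ε) (hwin : 2 * ((d : ℝ) + 1) * c * ε < m2) :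
    AnalyticOnNhd 𝕜 (fun UV : CxLinks K 𝕜 n => (cxLapF K c m2 UV.1 UV.2)⁻¹) {UV | (∀ b, ‖UV.1 b‖ ≤ 1 + ε) ∧ (∀ b, ‖UV.2 b‖ ≤ 1 + ε)} :=
  (analyticOnNhd_cxLapF_inv K c m2).mono (window_subset_setOf_isUnit K hc hm hε hwin)

/-- AT A UNITARY FIELD the two-sided inverse is PART Ͱ's covariant fine covariance: `G_{U₀,U₀^*} = (−cΔ_{U₀}+m²)⁻¹`. [cite: Balaban1985BackgroundPropagators, (3.23) p.394] -/
theorem cxLapF_inv_at_unitary (c m2 : ℝ) (U₀ : Tor K × Fin (d + 1) → Matrix n n 𝕜) :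
    (cxLapF K c m2 U₀ (fun b => (U₀ b)ᴴ))⁻¹ = (covLapF K c m2 U₀)⁻¹ := by
  rw [cxLapF_adjoint]

/-- ★★ **ANALYTIC AT EVERY UNITARY FIELD**: for `c ≥ 0`, `m² > 0`, `(U,V) ↦ G_{U,V}` is analytic at `(U₀, U₀^*)` for every unitary `U₀` — the real slice through which print complexifies.
[cite: Balaban1985BackgroundPropagators, §3.B p.399 l.37–40, Thm 3.4 p.400] -/
theorem analyticAt_cxLapF_inv_unitary {c m2 : ℝ} (hc : 0 ≤ c) (hm : 0 < m2) {U₀ : Tor K × Fin (d + 1) → Matrix n n 𝕜}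
    (hU₀ : ∀ b, U₀ b ∈ Matrix.unitaryGroup n 𝕜) :
    AnalyticAt 𝕜 (fun UV : CxLinks K 𝕜 n => (cxLapF K c m2 UV.1 UV.2)⁻¹) (U₀, fun b => (U₀ b)ᴴ) := by
  have hwin : 2 * ((d : ℝ) + 1) * c * 0 < m2 := by rw [mul_zero]; exact hm
  exact analyticAt_cxLapF_inv K (isUnit_cxLapF K hc hm le_rfl hwin (unitary_mem_window K hU₀).1 (unitary_mem_window K hU₀).2)

/-- ★★ THE BLOCKS `(U,V) ↦ (G_{U,V})_{xy}` are analytic on the invertibility locus. [cite: Balaban1985BackgroundPropagators, Thm 3.4 p.400] -/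
theorem analyticAt_blk_cxLapF_inv {c m2 : ℝ} {UV₀ : CxLinks K 𝕜 n} (hU : IsUnit (cxLapF K c m2 UV₀.1 UV₀.2)) (x y : Tor K) :
    AnalyticAt 𝕜 (fun UV : CxLinks K 𝕜 n => blk (cxLapF K c m2 UV.1 UV.2)⁻¹ x y) UV₀ :=
  ((cxBlkCLM K 𝕜 n x y).analyticAt _).comp (analyticAt_cxLapF_inv K hU)

/-- ★★ THE ENTRIES `(U,V) ↦ G_{U,V}(p,q)` are analytic (scalar-valued holomorphic functions of the link variables) on the invertibility locus.
[cite: Balaban1985BackgroundPropagators, Thm 3.4 p.400] -/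
theorem analyticAt_cxLapF_inv_entry {c m2 : ℝ} {UV₀ : CxLinks K 𝕜 n} (hU : IsUnit (cxLapF K c m2 UV₀.1 UV₀.2)) (p q : Tor K × n) :
    AnalyticAt 𝕜 (fun UV : CxLinks K 𝕜 n => (cxLapF K c m2 UV.1 UV.2)⁻¹ p q) UV₀ :=
  ((cxEntryCLM K 𝕜 p q).analyticAt _).comp (analyticAt_cxLapF_inv K hU)

/-- `G` is differentiable at every point of the invertibility locus. [folklore] -/
theorem differentiableAt_cxLapF_inv {c m2 : ℝ} {UV₀ : CxLinks K 𝕜 n} (hU : IsUnit (cxLapF K c m2 UV₀.1 UV₀.2)) :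
    DifferentiableAt 𝕜 (fun UV : CxLinks K 𝕜 n => (cxLapF K c m2 UV.1 UV.2)⁻¹) UV₀ :=
  (analyticAt_cxLapF_inv K hU).differentiableAt

/-- `G` is smooth (`C^∞`, indeed `C^ω`) at every point of the invertibility locus. [folklore] -/
theorem contDiffAt_cxLapF_inv {c m2 : ℝ} {UV₀ : CxLinks K 𝕜 n} (hU : IsUnit (cxLapF K c m2 UV₀.1 UV₀.2)) {m : WithTop ℕ∞} :
    ContDiffAt 𝕜 m (fun UV : CxLinks K 𝕜 n => (cxLapF K c m2 UV.1 UV.2)⁻¹) UV₀ :=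
  (analyticAt_cxLapF_inv K hU).contDiffAt

/-! ## §3 The exact derivative `∂G[δ] = G·T_δ·G` -/

/-- ★★★ **THE EXACT DERIVATIVE OF THE ANALYTIC EXTENSION**: at an invertible `M_{U,V}` with `G = M_{U,V}⁻¹`,
`D((U,V) ↦ G_{U,V}) = (δU,δV) ↦ G·T_{δU,δV}·G` — the derivative of `x ↦ x⁻¹` (`t ↦ −x⁻¹tx⁻¹`) composed with the affine `(U,V) ↦ D₀ − T_{U,V}`; the first-order term of print's
perturbation expansion around `U`. [cite: Balaban1985BackgroundPropagators, (3.53) p.400, (3.57) p.401, Thm 3.4 p.400] -/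
theorem hasFDerivAt_cxLapF_inv {c m2 : ℝ} {UV₀ : CxLinks K 𝕜 n} (hU : IsUnit (cxLapF K c m2 UV₀.1 UV₀.2)) :
    HasFDerivAt (fun UV : CxLinks K 𝕜 n => (cxLapF K c m2 UV.1 UV.2)⁻¹)
      ((ContinuousLinearMap.mulLeftRight 𝕜 (Matrix (Tor K × n) (Tor K × n) 𝕜) (cxLapF K c m2 UV₀.1 UV₀.2)⁻¹ (cxLapF K c m2 UV₀.1 UV₀.2)⁻¹).comp
        (cxHopCLM K 𝕜 n c)) UV₀ := by
  haveI : CompleteSpace (Matrix (Tor K × n) (Tor K × n) 𝕜) := FiniteDimensional.complete 𝕜 _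
  rw [cxLapF_inv_eq_ringInverse_comp]
  have h1 := hasFDerivAt_ringInverse (𝕜 := 𝕜) hU.unit
  have h2 : ((hU.unit⁻¹ : (Matrix (Tor K × n) (Tor K × n) 𝕜)ˣ) : Matrix (Tor K × n) (Tor K × n) 𝕜) = (cxLapF K c m2 UV₀.1 UV₀.2)⁻¹ := by
    rw [Matrix.coe_units_inv, hU.unit_spec]
  rw [h2, hU.unit_spec] at h1
  have h3 := h1.comp UV₀ (hasFDerivAt_cxLapF K c m2 UV₀)
  rwa [ContinuousLinearMap.neg_comp, ContinuousLinearMap.comp_neg, neg_neg] at h3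

/-- ★★ THE DERIVATIVE IN A DIRECTION: `∂_{(δU,δV)}G_{U,V} = G_{U,V}·T_{δU,δV}·G_{U,V}`. [cite: Balaban1985BackgroundPropagators, (3.53) p.400, (3.57) p.401] -/
theorem fderiv_cxLapF_inv_apply {c m2 : ℝ} {UV₀ : CxLinks K 𝕜 n} (hU : IsUnit (cxLapF K c m2 UV₀.1 UV₀.2)) (δ : CxLinks K 𝕜 n) :
    fderiv 𝕜 (fun UV : CxLinks K 𝕜 n => (cxLapF K c m2 UV.1 UV.2)⁻¹) UV₀ δ
      = (cxLapF K c m2 UV₀.1 UV₀.2)⁻¹ * cxHop K c δ.1 δ.2 * (cxLapF K c m2 UV₀.1 UV₀.2)⁻¹ := by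
  rw [(hasFDerivAt_cxLapF_inv K hU).fderiv, ContinuousLinearMap.comp_apply, cxHopCLM_apply, ContinuousLinearMap.mulLeftRight_apply]

/-- ★★ ON THE WINDOW the derivative formula holds at every point (Ϛ-b `isUnit_cxLapF`). [cite: Balaban1985BackgroundPropagators, Thm 3.4 p.400, (3.57) p.401] -/
theorem hasFDerivAt_cxLapF_inv_window {c m2 ε : ℝ} (hc : 0 ≤ c) (hm : 0 < m2) (hε : 0 ≤ ε) (hwin : 2 * ((d : ℝ) + 1) * c * ε < m2)
    {UV₀ : CxLinks K 𝕜 n} (hU : ∀ b, ‖UV₀.1 b‖ ≤ 1 + ε) (hV : ∀ b, ‖UV₀.2 b‖ ≤ 1 + ε) :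
    HasFDerivAt (fun UV : CxLinks K 𝕜 n => (cxLapF K c m2 UV.1 UV.2)⁻¹)
      ((ContinuousLinearMap.mulLeftRight 𝕜 (Matrix (Tor K × n) (Tor K × n) 𝕜) (cxLapF K c m2 UV₀.1 UV₀.2)⁻¹ (cxLapF K c m2 UV₀.1 UV₀.2)⁻¹).comp
        (cxHopCLM K 𝕜 n c)) UV₀ :=
  hasFDerivAt_cxLapF_inv K (isUnit_cxLapF K hc hm hε hwin hU hV)

end Summit.QuantumFields.YangMills.BalabanUVNodes.N15KingModelRung.Covariant

end
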